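import Summits.CriticalPhenomena.PercolationContinuityZ3.Theorems.PercNearOneGluingNoHeavyConstsSingleEdgeDisconnection
import Summits.CriticalPhenomena.PercolationContinuityZ3.Theorems.PercNearOneGluingNoHeavyConstsSingleEdgeChainRuleSEE
import HarnessLib
import HarnessLib.Audit.Tags

/-!
# The UNCONDITIONAL chain rule `T₁ ≥ 0` — the first of the two van den Berg–Häggström–Kahn inequalities between which the
# single-edge chain rule is sandwiched (PAPER-2 track (ii), constants of the CSH family)

builds on p205010 (kernel theorem, internal audit signed; external expert review pending).  Support file (`--supports
stmt-CriticalPhenomena-4575`), seat `prim-consts-2` (gen 4); rows A6/A11 of `run/shared/lean/prim/consts/CONSTANTS.md`; memo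
`run/shared/lean/prim/consts/FROM-prim-consts-2-g4-BERNSTEIN.md` §9.  No definitions, no sorries; standard axioms.

Notation: `μ = prodBernoulli w` on a finite vertex type, `K(S,T) = μ{S ↮ T}`, chain-rule data `x, u, v, o, Y`
(`Consts.SingleEdgeChainRule`), `Yv = Y ∪ {v}`, `Yo = Y ∪ {o}`.  The chain-rule determinant `Δ = det[K(S_i,T_j)]`
(`Consts.singleEdgeChainRule_slack_eq_det`) splits along its third row as `Δ = K(xuv,Y)·T₁ + K(xuv,Yo)·T₂`
(companion file `…ConstsChainRuleSandwich.lean`), where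

  `T₁ = K(xu,Yv)·[K(x,Yo) − K(xu,Yo)] − [K(x,Yv) − K(xu,Yv)]·[K(xu,Yo) − K(xuv,Yo)]`
      `= det [[K(x,Yv), 1, K(x,Yo)], [K(xu,Yv), 1, K(xu,Yo)], [0, 1, K(xuv,Yo)]]`,
  `T₂ = [K(x,Yv)K(xu,Y) − K(xu,Yv)K(x,Y)] − K(xuv,Y)·[K(x,Yv) − K(xu,Yv)]`.

* `Consts.unconditionalChainRule` — **THEOREM `T₁ ≥ 0`** ("unconditional chain rule": the chain-rule determinant with the
  normalising column `K(S_i,Y)` replaced by ones is nonnegative, i.e. the points `(μ(S_i↮Yv), μ(S_i↮Yo))` are concavely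
  arranged at the `v`-endpoint).  Proof = product of four vdBHK inequalities for the source SET `ρ = Y ∪ {v,o}` avoiding `x`:
  (1) `{v ↔ Yo}` (increasing in `C_ρ`) and `{u ∉ C_ρ}` (decreasing) are negatively correlated given `ρ ↮ x` (Thm 1.3 with sets);
  (2) reverse regularity `K(x,Yv)K(xu,Yvo) ≤ K(x,Yvo)K(xu,Yv)` (`Consts.disconnect_rr2`, Thm 1.5);
  (3) source monotonicity `P(u ∈ C_{Yv} ∣ Yv ↮ x) ≤ P(u ∈ C_{Yvo} ∣ Yvo ↮ x)` (`Consts.real_reach_avoid_insert_ge`, Thm 1.4);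
  (4) positive association of `{v ↔ Yo}`, `{u ∈ C_ρ}` given `ρ ↮ x` (Thm 1.3 with sets); then `{ρ↮x, v↔Yo, u∈C_ρ} ⊆ {x↮Yo, u↔Yo}`.
* (companion file `…ConstsChainRuleSandwich.lean`: `Consts.rr2Gap_le` — `T₂ ≤ 0`; the identity `Δ = K(xuv,Y)·T₁ + K(xuv,Yo)·T₂`;
  `Consts.singleEdgeChainRule_iff_sandwich`.)
* helpers `Consts.real_avoid_conn_mul_conn_le` / `Consts.real_avoid_conn_notConn_mul_le`: the event forms of Thm 1.3 with a
  source set for cluster events `{∃ s ∈ S', ∃ a ∈ A, s ↔ a}`, `S' ⊆ S`.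

In the three-copy language of `Consts.ChainRuleBernstein`, `T₁ ≥ 0` and `T₂ ≤ 0` are the (annealed) pattern inequalities
`#(1,3,2) ≤ #(2,3,1)` and `#(1,2,3) ≤ #(2,1,3)`; the open chain rule says the first surplus, weighted by `K(xuv,Y)`,
dominates the second, weighted by `K(xuv,Yo) ≤ K(xuv,Y)`.
[cite: VandenbergHaggstromKahn2005, Thm. 1.3 (p. 6), Thm. 1.4 (p. 7), Thm. 1.5 (p. 7), Thm. 2.1 (p. 9), Remark 1 after Thm. 1.2 (p. 5)]
-/

noncomputable section

namespace Summit.CriticalPhenomena.PercolationContinuityZ3.Theorems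

open MeasureTheory Set Literature.Probability.LatticeModels Literature.Probability.Percolation
open scoped Classical

namespace Consts

variable {V : Type*} [Fintype V]

omit [Fintype V] in
/-- Symmetry of the disconnection event: `{S ↮ T} = {T ↮ S}`. [folklore] -/
theorem setOf_avoid_comm (S T : Set V) :
    {ω : BondConfig V | ∀ s ∈ S, ∀ t ∈ T, ¬ (openGraph ω).Reachable s t} =
      {ω : BondConfig V | ∀ t ∈ T, ∀ s ∈ S, ¬ (openGraph ω).Reachable t s} := by
  ext ω
  exact ⟨fun h t ht s hs hts => h s hs t ht hts.symm, fun h s hs t ht hst => h t ht s hs hst.symm⟩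

/-- **vdBHK Thm 1.3 with a source SET, event form (positive association).**  For a source set `S` avoiding `X`
(`D = {S ↮ X}`) and two increasing cluster events `E_i = {∃ s ∈ S_i, ∃ a ∈ A_i, s ↔ a}` with `S_i ⊆ S`:
`μ(D ∩ E₁) · μ(D ∩ E₂) ≤ μ(D) · μ(D ∩ E₁ ∩ E₂)`.
[cite: VandenbergHaggstromKahn2005, Thm. 1.3 (p. 6) with Remark 1 after Thm. 1.2 (p. 5)] -/
theorem real_avoid_conn_mul_conn_le (w : Sym2 V → unitInterval) (S X : Set V) {S₁ S₂ : Set V}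
    (hS₁ : S₁ ⊆ S) (hS₂ : S₂ ⊆ S) (A₁ A₂ : Set V) :
    (prodBernoulli w).real ({ω : BondConfig V | ∀ s ∈ S, ∀ t ∈ X, ¬ (openGraph ω).Reachable s t} ∩
        {ω | ∃ s ∈ S₁, ∃ a ∈ A₁, (openGraph ω).Reachable s a}) *
      (prodBernoulli w).real ({ω : BondConfig V | ∀ s ∈ S, ∀ t ∈ X, ¬ (openGraph ω).Reachable s t} ∩
        {ω | ∃ s ∈ S₂, ∃ a ∈ A₂, (openGraph ω).Reachable s a}) ≤
    (prodBernoulli w).real {ω : BondConfig V | ∀ s ∈ S, ∀ t ∈ X, ¬ (openGraph ω).Reachable s t} *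
      (prodBernoulli w).real ({ω : BondConfig V | ∀ s ∈ S, ∀ t ∈ X, ¬ (openGraph ω).Reachable s t} ∩
        ({ω | ∃ s ∈ S₁, ∃ a ∈ A₁, (openGraph ω).Reachable s a} ∩
          {ω | ∃ s ∈ S₂, ∃ a ∈ A₂, (openGraph ω).Reachable s a})) := by
  classical
  set E₁ : Set (BondConfig V) := {ω | ∃ s ∈ S₁, ∃ a ∈ A₁, (openGraph ω).Reachable s a} with hE₁
  set E₂ : Set (BondConfig V) := {ω | ∃ s ∈ S₂, ∃ a ∈ A₂, (openGraph ω).Reachable s a} with hE₂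
  set F : Set (Sym2 V) → ℝ := fun C => if (∃ s ∈ S₁, ∃ a ∈ A₁, (openGraph C).Reachable s a) then (1 : ℝ) else 0 with hF
  set G : Set (Sym2 V) → ℝ := fun C => if (∃ s ∈ S₂, ∃ a ∈ A₂, (openGraph C).Reachable s a) then (1 : ℝ) else 0 with hG
  have hFm : Monotone F := by
    refine TripodExchange.predIndicator_monotone ?_
    rintro C C' hCC' ⟨s, hs, a, ha, hr⟩
    exact ⟨s, hs, a, ha, hr.mono (openGraph_mono hCC')⟩
  have hGm : Monotone G := by
    refine TripodExchange.predIndicator_monotone ?_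
    rintro C C' hCC' ⟨s, hs, a, ha, hr⟩
    exact ⟨s, hs, a, ha, hr.mono (openGraph_mono hCC')⟩
  have hFω : ∀ ω : BondConfig V, F (⋃ s ∈ S, openEdgeCluster ω s) = E₁.indicator 1 ω := by
    intro ω
    have hiff : (∃ s ∈ S₁, ∃ a ∈ A₁, (openGraph (⋃ s' ∈ S, openEdgeCluster ω s')).Reachable s a) ↔
        ∃ s ∈ S₁, ∃ a ∈ A₁, (openGraph ω).Reachable s a := by
      constructor
      · rintro ⟨s, hs, a, ha, hr⟩; exact ⟨s, hs, a, ha, (KNSep.reachable_iff_cluster ω S (hS₁ hs) a).2 hr⟩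
      · rintro ⟨s, hs, a, ha, hr⟩; exact ⟨s, hs, a, ha, (KNSep.reachable_iff_cluster ω S (hS₁ hs) a).1 hr⟩
    simp only [hF, hiff]
    exact TwoSetConditionalAssociation.predIndicator_eq_indicator
      (fun ω' => ∃ s ∈ S₁, ∃ a ∈ A₁, (openGraph ω').Reachable s a) ω
  have hGω : ∀ ω : BondConfig V, G (⋃ s ∈ S, openEdgeCluster ω s) = E₂.indicator 1 ω := by
    intro ω
    have hiff : (∃ s ∈ S₂, ∃ a ∈ A₂, (openGraph (⋃ s' ∈ S, openEdgeCluster ω s')).Reachable s a) ↔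
        ∃ s ∈ S₂, ∃ a ∈ A₂, (openGraph ω).Reachable s a := by
      constructor
      · rintro ⟨s, hs, a, ha, hr⟩; exact ⟨s, hs, a, ha, (KNSep.reachable_iff_cluster ω S (hS₂ hs) a).2 hr⟩
      · rintro ⟨s, hs, a, ha, hr⟩; exact ⟨s, hs, a, ha, (KNSep.reachable_iff_cluster ω S (hS₂ hs) a).1 hr⟩
    simp only [hG, hiff]
    exact TwoSetConditionalAssociation.predIndicator_eq_indicator
      (fun ω' => ∃ s ∈ S₂, ∃ a ∈ A₂, (openGraph ω').Reachable s a) ω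
  have key := BHK2006_setClusterConditionalPositiveAssociation w S X F G hFm hGm
  simp only [hFω, hGω, TripodExchange.setIntegral_indicator_one_eq,
    TripodExchange.setIntegral_indicator_mul_indicator_eq] at key
  exact key

/-- **vdBHK Thm 1.3 with a source SET: an increasing and a decreasing cluster event are negatively correlated.**
With `D = {S ↮ X}`, `E_i = {∃ s ∈ S_i, ∃ a ∈ A_i, s ↔ a}` (`S_i ⊆ S`): `μ(D ∩ E₁ ∩ E₂ᶜ) · μ(D) ≤ μ(D ∩ E₁) · μ(D ∩ E₂ᶜ)`.
[cite: VandenbergHaggstromKahn2005, Thm. 1.3 (p. 6) with Remark 1 after Thm. 1.2 (p. 5)] -/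
theorem real_avoid_conn_notConn_mul_le (w : Sym2 V → unitInterval) (S X : Set V) {S₁ S₂ : Set V}
    (hS₁ : S₁ ⊆ S) (hS₂ : S₂ ⊆ S) (A₁ A₂ : Set V) :
    (prodBernoulli w).real ({ω : BondConfig V | ∀ s ∈ S, ∀ t ∈ X, ¬ (openGraph ω).Reachable s t} ∩
        {ω | ∃ s ∈ S₁, ∃ a ∈ A₁, (openGraph ω).Reachable s a} ∩
          {ω | ∃ s ∈ S₂, ∃ a ∈ A₂, (openGraph ω).Reachable s a}ᶜ) *
      (prodBernoulli w).real {ω : BondConfig V | ∀ s ∈ S, ∀ t ∈ X, ¬ (openGraph ω).Reachable s t} ≤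
    (prodBernoulli w).real ({ω : BondConfig V | ∀ s ∈ S, ∀ t ∈ X, ¬ (openGraph ω).Reachable s t} ∩
        {ω | ∃ s ∈ S₁, ∃ a ∈ A₁, (openGraph ω).Reachable s a}) *
      (prodBernoulli w).real ({ω : BondConfig V | ∀ s ∈ S, ∀ t ∈ X, ¬ (openGraph ω).Reachable s t} ∩
        {ω | ∃ s ∈ S₂, ∃ a ∈ A₂, (openGraph ω).Reachable s a}ᶜ) := by
  classical
  set μ := prodBernoulli w with hμ
  have hmeas : ∀ T : Set (BondConfig V), MeasurableSet T := fun _ => MeasurableSet.of_discrete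
  set D : Set (BondConfig V) := {ω | ∀ s ∈ S, ∀ t ∈ X, ¬ (openGraph ω).Reachable s t} with hD
  set E₁ : Set (BondConfig V) := {ω | ∃ s ∈ S₁, ∃ a ∈ A₁, (openGraph ω).Reachable s a} with hE₁
  set E₂ : Set (BondConfig V) := {ω | ∃ s ∈ S₂, ∃ a ∈ A₂, (openGraph ω).Reachable s a} with hE₂
  have key := real_avoid_conn_mul_conn_le w S X hS₁ hS₂ A₁ A₂
  -- key : μ.real (D ∩ E₁) * μ.real (D ∩ E₂) ≤ μ.real D * μ.real (D ∩ (E₁ ∩ E₂))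
  have h1 : μ.real (D ∩ E₁ ∩ E₂ᶜ) = μ.real (D ∩ E₁) - μ.real (D ∩ (E₁ ∩ E₂)) := by
    have h := measureReal_inter_add_sdiff (μ := μ) (s := D ∩ E₁) (hmeas E₂)
    have hset1 : D ∩ E₁ ∩ E₂ = D ∩ (E₁ ∩ E₂) := inter_assoc D E₁ E₂
    have hset2 : (D ∩ E₁) \ E₂ = D ∩ E₁ ∩ E₂ᶜ := rfl
    rw [hset1, hset2] at h; linarith
  have h2 : μ.real (D ∩ E₂ᶜ) = μ.real D - μ.real (D ∩ E₂) := by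
    have h := measureReal_inter_add_sdiff (μ := μ) (s := D) (hmeas E₂)
    have hset : D \ E₂ = D ∩ E₂ᶜ := rfl
    rw [hset] at h; linarith
  rw [h1, h2]
  nlinarith [key]

/-- **THEOREM `T₁ ≥ 0` — the UNCONDITIONAL chain rule.**  For every finite weighted graph, vertices `x, u, v, o` and a vertex set `Y`:
`[K(x,Yv) − K(xu,Yv)] · [K(xu,Yo) − K(xuv,Yo)] ≤ K(xu,Yv) · [K(x,Yo) − K(xu,Yo)]` (`K(S,T) = μ{S ↮ T}`, `Yv = Y ∪ {v}`,
`Yo = Y ∪ {o}`), i.e. `μ(x↮Yv, u↔Yv)·μ(xu↮Yo, v↔Yo) ≤ μ(xu↮Yv)·μ(x↮Yo, u↔Yo)`, i.e.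
`det [[K(x,Yv), 1, K(x,Yo)], [K(xu,Yv), 1, K(xu,Yo)], [0, 1, K(xuv,Yo)]] ≥ 0`.  Product of four
van den Berg–Häggström–Kahn inequalities for the source set `Y ∪ {v, o}` avoiding `x` (module docstring).
[cite: VandenbergHaggstromKahn2005, Thm. 1.3 (p. 6), Thm. 1.4 (p. 7), Thm. 1.5 (p. 7), Remark 1 after Thm. 1.2 (p. 5)] -/
theorem unconditionalChainRule (w : Sym2 V → unitInterval) (x u v o : V) (Y : Set V) :
    ((prodBernoulli w).real {ω : BondConfig V | ∀ s ∈ ({x} : Set V), ∀ t ∈ insert v Y, ¬ (openGraph ω).Reachable s t} -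
        (prodBernoulli w).real {ω : BondConfig V | ∀ s ∈ ({x, u} : Set V), ∀ t ∈ insert v Y,
          ¬ (openGraph ω).Reachable s t}) *
      ((prodBernoulli w).real {ω : BondConfig V | ∀ s ∈ ({x, u} : Set V), ∀ t ∈ insert o Y, ¬ (openGraph ω).Reachable s t} -
        (prodBernoulli w).real {ω : BondConfig V | ∀ s ∈ ({x, u, v} : Set V), ∀ t ∈ insert o Y,
          ¬ (openGraph ω).Reachable s t}) ≤
    (prodBernoulli w).real {ω : BondConfig V | ∀ s ∈ ({x, u} : Set V), ∀ t ∈ insert v Y, ¬ (openGraph ω).Reachable s t} *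
      ((prodBernoulli w).real {ω : BondConfig V | ∀ s ∈ ({x} : Set V), ∀ t ∈ insert o Y, ¬ (openGraph ω).Reachable s t} -
        (prodBernoulli w).real {ω : BondConfig V | ∀ s ∈ ({x, u} : Set V), ∀ t ∈ insert o Y,
          ¬ (openGraph ω).Reachable s t}) := by
  classical
  set μ := prodBernoulli w with hμ
  have hmeas : ∀ T : Set (BondConfig V), MeasurableSet T := fun _ => MeasurableSet.of_discrete
  -- the two source sets seen from the `Y`-side
  set ρ : Set V := insert v (insert o Y) with hρ
  set σ : Set V := insert v Y with hσ
  have hσρ : σ ⊆ ρ := insert_subset_insert (subset_insert _ _)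
  have hYo_ρ : insert o Y ⊆ ρ := subset_insert _ _
  have hvρ : ({v} : Set V) ⊆ ρ := singleton_subset_iff.2 (mem_insert _ _)
  have hxxu : ({x} : Set V) ⊆ ({x, u} : Set V) := singleton_subset_iff.2 (mem_insert _ _)
  -- kernel entries
  set K1v := μ.real {ω : BondConfig V | ∀ s ∈ ({x} : Set V), ∀ t ∈ insert v Y, ¬ (openGraph ω).Reachable s t} with hK1v
  set K2v := μ.real {ω : BondConfig V | ∀ s ∈ ({x, u} : Set V), ∀ t ∈ insert v Y, ¬ (openGraph ω).Reachable s t}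
    with hK2v
  set K1o := μ.real {ω : BondConfig V | ∀ s ∈ ({x} : Set V), ∀ t ∈ insert o Y, ¬ (openGraph ω).Reachable s t} with hK1o
  set K2o := μ.real {ω : BondConfig V | ∀ s ∈ ({x, u} : Set V), ∀ t ∈ insert o Y, ¬ (openGraph ω).Reachable s t}
    with hK2o
  set K3o := μ.real {ω : BondConfig V | ∀ s ∈ ({x, u, v} : Set V), ∀ t ∈ insert o Y, ¬ (openGraph ω).Reachable s t}
    with hK3o
  -- events for the source sets `ρ`, `σ`
  set Dρ : Set (BondConfig V) := {ω | ∀ s ∈ ρ, ∀ t ∈ ({x} : Set V), ¬ (openGraph ω).Reachable s t} with hDρ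
  set Dρu : Set (BondConfig V) := {ω | ∀ s ∈ ρ, ∀ t ∈ ({x, u} : Set V), ¬ (openGraph ω).Reachable s t} with hDρu
  set Dσ : Set (BondConfig V) := {ω | ∀ s ∈ σ, ∀ t ∈ ({x} : Set V), ¬ (openGraph ω).Reachable s t} with hDσ
  set E₁ : Set (BondConfig V) := {ω | ∃ s ∈ ({v} : Set V), ∃ a ∈ insert o Y, (openGraph ω).Reachable s a} with hE₁
  set E₂ : Set (BondConfig V) := {ω | ∃ s ∈ ρ, ∃ a ∈ ({u} : Set V), (openGraph ω).Reachable s a} with hE₂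
  set Eu : Set (BondConfig V) := {ω | ∃ s ∈ σ, (openGraph ω).Reachable s u} with hEu
  -- (0) `Dρ ∩ E₂ᶜ = Dρu` and `Dρu ⊆ Dρ`
  have hDρu_eq : Dρ ∩ E₂ᶜ = Dρu := by
    ext ω
    constructor
    · rintro ⟨h1, h2⟩ s hs t ht
      rcases (show t = x ∨ t = u by simpa using ht) with rfl | rfl
      · exact h1 s hs t (mem_singleton _)
      · exact fun h => h2 ⟨s, hs, t, mem_singleton _, h⟩
    · intro h
      refine ⟨fun s hs t ht => ?_, ?_⟩
      · rw [mem_singleton_iff] at ht; subst ht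
        exact h s hs t (by simp)
      · rintro ⟨s, hs, a, ha, hsa⟩
        rw [mem_singleton_iff] at ha; subst ha
        exact h s hs a (by simp) hsa
  have hDρu_sub : Dρu ⊆ Dρ := by
    intro ω hω s hs t ht
    rw [mem_singleton_iff] at ht; subst ht
    exact hω s hs t (by simp)
  -- (b) `K(xu,Yo) − K(xuv,Yo) = μ(Dρu ∩ E₁)`
  have hb : K2o - K3o = μ.real (Dρu ∩ E₁) := by
    have hsub : {ω : BondConfig V | ∀ s ∈ ({x, u, v} : Set V), ∀ t ∈ insert o Y, ¬ (openGraph ω).Reachable s t} ⊆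
        {ω : BondConfig V | ∀ s ∈ ({x, u} : Set V), ∀ t ∈ insert o Y, ¬ (openGraph ω).Reachable s t} := by
      intro ω h s hs t ht
      rcases (show s = x ∨ s = u by simpa using hs) with rfl | rfl
      · exact h s (by simp) t ht
      · exact h s (by simp) t ht
    have hdiff : {ω : BondConfig V | ∀ s ∈ ({x, u} : Set V), ∀ t ∈ insert o Y, ¬ (openGraph ω).Reachable s t} \
        {ω : BondConfig V | ∀ s ∈ ({x, u, v} : Set V), ∀ t ∈ insert o Y, ¬ (openGraph ω).Reachable s t} = Dρu ∩ E₁ := by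
      ext ω
      constructor
      · rintro ⟨hA, hB⟩
        have hA' : ∀ s ∈ ({x, u} : Set V), ∀ t ∈ insert o Y, ¬ (openGraph ω).Reachable s t := hA
        have hv : ∃ a ∈ insert o Y, (openGraph ω).Reachable v a := by
          by_contra hno
          apply hB
          intro s hs t ht
          rcases (show s = x ∨ s = u ∨ s = v by simpa using hs) with rfl | rfl | rfl
          · exact hA' s (by simp) t ht
          · exact hA' s (by simp) t ht
          · exact fun h => hno ⟨t, ht, h⟩
        obtain ⟨a, ha, hva⟩ := hv
        refine ⟨fun s hs t ht => ?_, ⟨v, mem_singleton _, a, ha, hva⟩⟩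
        rcases (mem_insert_iff.1 hs) with rfl | hs'
        · exact fun h => hA' t ht a ha (h.symm.trans hva)
        · exact fun h => hA' t ht s hs' h.symm
      · rintro ⟨hD, s, hs, a, ha, hsa⟩
        rw [mem_singleton_iff] at hs; subst hs
        refine ⟨fun s' hs' t ht h => hD t (hYo_ρ ht) s' hs' h.symm, fun hall => ?_⟩
        exact hall s (by simp) a ha hsa
    rw [hK2o, hK3o, ← measureReal_sdiff hsub (hmeas _), hdiff]
  -- (d) `μ(Dρ ∩ E₁ ∩ E₂) ≤ K(x,Yo) − K(xu,Yo)`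
  have hd : μ.real (Dρ ∩ (E₁ ∩ E₂)) ≤ K1o - K2o := by
    have hsub : {ω : BondConfig V | ∀ s ∈ ({x, u} : Set V), ∀ t ∈ insert o Y, ¬ (openGraph ω).Reachable s t} ⊆
        {ω : BondConfig V | ∀ s ∈ ({x} : Set V), ∀ t ∈ insert o Y, ¬ (openGraph ω).Reachable s t} :=
      fun ω h s hs t ht => h s (hxxu hs) t ht
    rw [hK1o, hK2o, ← measureReal_sdiff hsub (hmeas _)]
    refine measureReal_mono ?_
    rintro ω ⟨hD, ⟨s, hs, a, ha, hsa⟩, ⟨s', hs', b, hb', hsb⟩⟩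
    rw [mem_singleton_iff] at hs hb'
    subst hs; subst hb'
    refine ⟨fun s'' hs'' t ht h => ?_, fun hall => ?_⟩
    · rw [mem_singleton_iff] at hs''; subst hs''
      exact hD t (hYo_ρ ht) s'' (mem_singleton _) h.symm
    · have hall' : ∀ s'' ∈ ({x, b} : Set V), ∀ t ∈ insert o Y, ¬ (openGraph ω).Reachable s'' t := hall
      rcases (mem_insert_iff.1 hs') with rfl | hs'Yo
      · exact hall' b (by simp) a ha (hsb.symm.trans hsa)
      · exact hall' b (by simp) s' hs'Yo hsb.symm
  -- (a) `K(x,Yv) − K(xu,Yv) = μ(Dσ ∩ Eu)`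
  have ha : K1v - K2v = μ.real (Dσ ∩ Eu) := by
    have hsub : {ω : BondConfig V | ∀ s ∈ ({x, u} : Set V), ∀ t ∈ insert v Y, ¬ (openGraph ω).Reachable s t} ⊆
        {ω : BondConfig V | ∀ s ∈ ({x} : Set V), ∀ t ∈ insert v Y, ¬ (openGraph ω).Reachable s t} :=
      fun ω h s hs t ht => h s (hxxu hs) t ht
    have hdiff : {ω : BondConfig V | ∀ s ∈ ({x} : Set V), ∀ t ∈ insert v Y, ¬ (openGraph ω).Reachable s t} \
        {ω : BondConfig V | ∀ s ∈ ({x, u} : Set V), ∀ t ∈ insert v Y, ¬ (openGraph ω).Reachable s t} = Dσ ∩ Eu := by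
      ext ω
      constructor
      · rintro ⟨hA, hB⟩
        have hA' : ∀ s ∈ ({x} : Set V), ∀ t ∈ insert v Y, ¬ (openGraph ω).Reachable s t := hA
        have hu : ∃ s ∈ σ, (openGraph ω).Reachable s u := by
          by_contra hno
          apply hB
          intro s hs t ht
          rcases (show s = x ∨ s = u by simpa using hs) with rfl | rfl
          · exact hA' s (mem_singleton _) t ht
          · exact fun h => hno ⟨t, ht, h.symm⟩
        refine ⟨fun s hs t ht => ?_, hu⟩
        rw [mem_singleton_iff] at ht; subst ht
        exact fun h => hA' t (mem_singleton _) s hs h.symm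
      · rintro ⟨hD, s, hs, hsu⟩
        refine ⟨fun s' hs' t ht h => ?_, fun hall => ?_⟩
        · rw [mem_singleton_iff] at hs'; subst hs'
          exact hD t ht s' (mem_singleton _) h.symm
        · have hall' : ∀ s' ∈ ({x, u} : Set V), ∀ t ∈ insert v Y, ¬ (openGraph ω).Reachable s' t := hall
          exact hall' u (by simp) s hs hsu.symm
    rw [hK1v, hK2v, ← measureReal_sdiff hsub (hmeas _), hdiff]
  -- the four vdBHK inequalities
  -- (1) incr × decr for `ρ`: `μ(Dρu ∩ E₁) μ(Dρ) ≤ μ(Dρ ∩ E₁) μ(Dρu)`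
  have h1 : μ.real (Dρu ∩ E₁) * μ.real Dρ ≤ μ.real (Dρ ∩ E₁) * μ.real Dρu := by
    have := real_avoid_conn_notConn_mul_le w ρ ({x} : Set V) hvρ subset_rfl (insert o Y) ({u} : Set V)
    have hset : Dρ ∩ E₁ ∩ E₂ᶜ = Dρu ∩ E₁ := by
      rw [inter_assoc, inter_comm E₁ E₂ᶜ, ← inter_assoc, hDρu_eq]
    rw [hset, hDρu_eq] at this
    exact this
  -- (2) reverse regularity: `K(x,σ) K(xu,ρ) ≤ K(x,ρ) K(xu,σ)`
  have h2 : μ.real Dσ * μ.real Dρu ≤ μ.real Dρ * K2v := by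
    have := disconnect_rr2 w (S₁ := ({x} : Set V)) (S₂ := ({x, u} : Set V)) (T₁ := σ) (T₂ := ρ) hxxu hσρ
    rw [setOf_avoid_comm ({x} : Set V) σ, setOf_avoid_comm ({x, u} : Set V) ρ, setOf_avoid_comm ({x} : Set V) ρ] at this
    exact this
  -- (3) source monotonicity: `μ(Dσ ∩ Eu) μ(Dρ) ≤ μ(Dρ ∩ E₂) μ(Dσ)`
  have h3 : μ.real (Dσ ∩ Eu) * μ.real Dρ ≤ μ.real (Dρ ∩ E₂) * μ.real Dσ := by
    have := real_reach_avoid_insert_ge w σ ({x} : Set V) o u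
    have hρ' : insert o σ = ρ := insert_comm o v Y
    have hE₂' : {ω : BondConfig V | ∃ s ∈ ρ, (openGraph ω).Reachable s u} = E₂ := by
      ext ω
      constructor
      · rintro ⟨s, hs, h⟩; exact ⟨s, hs, u, mem_singleton _, h⟩
      · rintro ⟨s, hs, a, ha', h⟩
        rw [mem_singleton_iff] at ha'; subst ha'
        exact ⟨s, hs, h⟩
    rw [hρ', hE₂'] at this
    exact this
  -- (4) positive association for `ρ`: `μ(Dρ ∩ E₁) μ(Dρ ∩ E₂) ≤ μ(Dρ) μ(Dρ ∩ (E₁ ∩ E₂))`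
  have h4 : μ.real (Dρ ∩ E₁) * μ.real (Dρ ∩ E₂) ≤ μ.real Dρ * μ.real (Dρ ∩ (E₁ ∩ E₂)) :=
    real_avoid_conn_mul_conn_le w ρ ({x} : Set V) hvρ subset_rfl (insert o Y) ({u} : Set V)
  -- bookkeeping
  have hPn : 0 ≤ μ.real Dρ := measureReal_nonneg
  have hQn : 0 ≤ μ.real Dσ := measureReal_nonneg
  have hGn : 0 ≤ μ.real Dρu := measureReal_nonneg
  have hFn : 0 ≤ μ.real (Dρ ∩ E₂) := measureReal_nonneg
  have hbn : 0 ≤ μ.real (Dρu ∩ E₁) := measureReal_nonneg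
  have hcn : 0 ≤ K2v := measureReal_nonneg
  have hdn : 0 ≤ K1o - K2o := le_trans measureReal_nonneg hd
  rw [ha, hb]
  have hstep1 : (μ.real (Dσ ∩ Eu) * μ.real Dρ) * (μ.real (Dρu ∩ E₁) * μ.real Dρ) ≤
      (μ.real (Dρ ∩ E₂) * μ.real Dσ) * (μ.real (Dρ ∩ E₁) * μ.real Dρu) :=
    mul_le_mul h3 h1 (mul_nonneg hbn hPn) (mul_nonneg hFn hQn)
  have hstep2 : (μ.real (Dρ ∩ E₁) * μ.real (Dρ ∩ E₂)) * (μ.real Dσ * μ.real Dρu) ≤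
      (μ.real Dρ * (K1o - K2o)) * (μ.real Dρ * K2v) :=
    mul_le_mul (le_trans h4 (mul_le_mul_of_nonneg_left hd hPn)) h2 (mul_nonneg hQn hGn) (mul_nonneg hPn hdn)
  have hmain : (μ.real (Dσ ∩ Eu) * μ.real (Dρu ∩ E₁)) * (μ.real Dρ * μ.real Dρ) ≤
      (K2v * (K1o - K2o)) * (μ.real Dρ * μ.real Dρ) := by
    calc (μ.real (Dσ ∩ Eu) * μ.real (Dρu ∩ E₁)) * (μ.real Dρ * μ.real Dρ)
        = (μ.real (Dσ ∩ Eu) * μ.real Dρ) * (μ.real (Dρu ∩ E₁) * μ.real Dρ) := by ring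
      _ ≤ (μ.real (Dρ ∩ E₂) * μ.real Dσ) * (μ.real (Dρ ∩ E₁) * μ.real Dρu) := hstep1
      _ = (μ.real (Dρ ∩ E₁) * μ.real (Dρ ∩ E₂)) * (μ.real Dσ * μ.real Dρu) := by ring
      _ ≤ (μ.real Dρ * (K1o - K2o)) * (μ.real Dρ * K2v) := hstep2
      _ = (K2v * (K1o - K2o)) * (μ.real Dρ * μ.real Dρ) := by ring
  rcases hPn.eq_or_lt with hP0 | hPpos
  · -- `μ(Dρ) = 0`: then `μ(Dρu ∩ E₁) ≤ μ(Dρu) ≤ μ(Dρ) = 0`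
    have hGP : μ.real Dρu ≤ μ.real Dρ := measureReal_mono hDρu_sub
    have hbG : μ.real (Dρu ∩ E₁) ≤ μ.real Dρu := measureReal_mono inter_subset_left
    have hb0 : μ.real (Dρu ∩ E₁) = 0 := le_antisymm (by linarith) hbn
    rw [hb0, mul_zero]
    exact mul_nonneg hcn hdn
  · exact le_of_mul_le_mul_right hmain (mul_pos hPpos hPpos)

end Consts

end Summit.CriticalPhenomena.PercolationContinuityZ3.Theorems

end
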